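import Summits.BirchSwinnertonDyer.BirchSwinnertonDyer.Theorems.AdditiveKolyvaginRoadBottomRankOneAdditiveClassOfPoint
import Summits.BirchSwinnertonDyer.BirchSwinnertonDyer.Theorems.AdditiveKolyvaginRoadLevelMembership
import Summits.BirchSwinnertonDyer.Rank1Residual.X11b.KolyvaginBottomPoint
import Literature.NumberTheory.EllipticCurves.HeegnerPointsKolyvaginPrimaryLeavesProofs
import Literature.NumberTheory.EllipticCurves.HeegnerPointReflectionHolds
import Literature.NumberTheory.EllipticCurves.BSDSelmerCMPConverseHeegnerFieldProofs
import Literature.NumberTheory.EllipticCurves.NonEisensteinPrimeOfSurjective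
import HarnessLib

/-!
# Route `AdditiveKolyvaginRoad`, crux `LevelKolyvaginSystemsAdditive` (item stmt-BirchSwinnertonDyer-21396, KS′):
# the `selmer_bottom` binder of the rigidity chain DISCHARGED — the conductor-one Kolyvagin class `c(1)` is a SIGNED
# Selmer class: `c(1) ∈ Sel_∅^{−w(E)}`
# (cell `pub/bsd-wall`, width seat `bsd-wall-akr-p2x-w3` g3; `--supports stmt-BirchSwinnertonDyer-21396`, helper)

WHY. Every assembly of the rigidity chain for KS′ (width seat w2 g2's `nonempty_levelKolyvaginSystemP_of_bipartite_of_seed`,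
`…_of_reciprocity_of_ignition`, parts 5–8, and this seat's `…_of_seed_of_poitouTate` ∕ `…_of_published_free`) carries the binder
`selmer_bottom : ∃ μ, κ₀ ∅ ∅ ∈ SelQP W K p c ∅ μ` — the conductor-ONE bottom class of the level system is a SIGNED Selmer class
(RIGIDITY-SOCKET §2: «Gross 1991: `c(1) = δ(y_K) ∈ Sel` with sign; vacuous when `c(1) ≡ 0`; dischargeable E-side»). By
`realisation`, `κ₀ ∅ ∅` is `d.kolyvaginClass _ 1` for a conductor-`1` Kolyvagin–Heegner datum `d`. THIS FILE discharges it: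
* `kolyvaginClass_one_eq_kummerMapTorsion` — `c(1) = δ(y_K)`: for a conductor-`1` datum `d` and `P₀ ∈ E(K)` over `P(1)`
  (akr-p3's `exists_isHeegnerPoint_map_eq_derivedPoint_one`: such a `P₀` exists and is a Heegner point), on the admissible
  branch `d.kolyvaginClass _ 1 = kummerMapTorsion P₀` (`KolyvaginBottom.toGeomPoints_map_algebraMap` + Gross (4.4)
  `kolyvaginClass_toGeomPoints`); on the junk branch it is `0`.
* `kummerMapTorsion_mem_selQP_empty_of_isHeegnerPoint` — for a Heegner point `P₀ ∈ E(K)` (`IsHeegnerPoint`) at a frame with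
  `ρ̄_{E,p}` irreducible (so `E(K)[p] = 0`), `K` imaginary quadratic with the Heegner hypothesis and `c ≠ 1`:
  `δ(P₀) ∈ SelQP W K p c ∅ μ` with `sgnP μ = −w(E/ℚ)` — Selmer at every place (`kummerMapTorsion_mem_selmerLocalKer`), and
  `c_* δ(P₀) = δ(c P₀)` (`conjAct_kummerMapTorsion`) `= δ(−w P₀ + t) = −w δ(P₀)` by the PROVED reflection fact
  `heegnerPoint_conj_add_rootNumber_smul_holds` (Darmon Prop. 3.11: `c P_K = −w P_K` mod torsion) and `δ(t) = 0` for the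
  prime-to-`p` torsion point `t` (`exists_pow_smul_eq_of_isOfFinAddOrder`).
* `kolyvaginClass_one_mem_selQP_empty` and the binder form `selmer_bottom_of_realisation` (`∃ μ, κ₀ ∅ ∅ ∈ SelQP W K p c ∅ μ`
  from `realisation` at `m = ∅`).

HONEST FRAMING: theorems only; 0 definitions, 0 named facts, 0 `sorry`; the frame hypotheses (`p` odd, `ρ̄` onto, `K` imaginary
quadratic, Heegner hypothesis, `c ≠ 1`) are those of the crux; closes nothing. BSD is not proved by any of this.

References: [cite: GrossLMS1991, §4 (4.4), Prop. 5.3, §5 (5.1), Prop. 6.2] [cite: Darmon2004, Prop. 3.11, Thm. 3.7, §3.9]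
[cite: McCallumLMS1991, §4 (6)] [cite: SilvermanAEC2009, X.§4].
-/

-- single-conjunct summit: `Summit.BirchSwinnertonDyer.BirchSwinnertonDyer.…` repeats the name by design
set_option linter.dupNamespace false

noncomputable section

open scoped Classical

namespace Summit.BirchSwinnertonDyer.BirchSwinnertonDyer.Theorems.AdditiveKoly

open WeierstrassCurve NumberField IsDedekindDomain Field
  Literature.NumberTheory.EllipticCurves Literature.NumberTheory.EllipticCurves.ModularForms
  Literature.NumberTheory.EllipticCurves.Rank1Residual Literature.NumberTheory.EllipticCurves.KolyvaginCocycle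
  Literature.NumberTheory.GaloisRepresentations
  Summit.BirchSwinnertonDyer.Rank1Residual Summit.BirchSwinnertonDyer.Rank1Residual.X11b
  Summit.BirchSwinnertonDyer.Rank1Residual.X11b.Three

-- `K : Type`: the tree's ring-class class field theory is universe `0` (as in the crux).
variable (W : WeierstrassCurve ℚ) [W.IsElliptic] [W.IsGloballyMinimal] [NeZero (W.conductorNorm ℤ)]
  (p : ℕ) [hp : Fact p.Prime] (K : Type) [Field K] [NumberField K] [Module (ZMod p) (Vp W K p)]
  (Dt : ModularParametrizationData W (W.conductorNorm ℤ)) (β : ℤ) (ι : K →+* ℂ)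

/-! ## §1 `c(1) = δ(y_K)` -/

omit [W.IsElliptic] [W.IsGloballyMinimal] [Module (ZMod p) (Vp W K p)] in
/-- **`c(1) = δ(P₀)` on the admissible branch** (Gross 1991 (4.4) with `P_1 = y_K`; McCallum (6)): for a conductor-`1`
datum `d` whose derived point `P(1) ∈ E(K[1])` is the image of `P₀ ∈ E(K)`, IF `E(K[1]) ⊆ E(K̄)` is admissible for `p` and
`[P(1)]` is `Γ_K`-invariant mod `p` (the non-junk branch of `d.kolyvaginClass`), then `d.kolyvaginClass _ 1` is the Kummer
class `δ(P₀) ∈ H¹(K, E[p])`. [cite: GrossLMS1991, §4 (4.4)] [cite: McCallumLMS1991, §4 (6)] -/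
theorem kolyvaginClass_one_eq_kummerMapTorsion (d : KolyvaginHeegnerData Dt β ι 1)
    (P₀ : (W.baseChange K).toAffine.Point)
    (hP₀ : WeierstrassCurve.Affine.Point.map (W' := W) (algebraMap K (ringClassField K ι 1)).toRatAlgHom P₀ =
      d.derivedPoint)
    (hA : IsAdmissible (absoluteGaloisGroup K) d.pointsSubgroup ((p ^ 1 : ℕ) : ℤ))
    (hP : d.toGeomPoints d.derivedPoint ∈ invPoints (absoluteGaloisGroup K) d.pointsSubgroup ((p ^ 1 : ℕ) : ℤ)) :
    d.kolyvaginClass hp.out 1 =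
      kummerMapTorsion (W.baseChange K) ((p ^ 1 : ℕ) : ℤ)
        ((W.baseChange K).zsmul_geomPoints_surjective_of_charZero (by exact_mod_cast pow_ne_zero 1 hp.out.ne_zero))
        P₀ := by
  rw [d.kolyvaginClass_of_admissible hp.out 1 hA hP]
  have hgeom : d.toGeomPoints d.derivedPoint = toGeomPoints (W.baseChange K) P₀ := by
    rw [← hP₀]; exact KolyvaginBottom.toGeomPoints_map_algebraMap d P₀
  have key : ∀ (P : geomPoints (W.baseChange K))
      (hP' : P ∈ invPoints (absoluteGaloisGroup K) d.pointsSubgroup ((p ^ 1 : ℕ) : ℤ)),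
      P = toGeomPoints (W.baseChange K) P₀ →
      Literature.NumberTheory.EllipticCurves.kolyvaginClass (W.baseChange K) ((p ^ 1 : ℕ) : ℤ)
        ((W.baseChange K).zsmul_geomPoints_surjective_of_charZero (by exact_mod_cast pow_ne_zero 1 hp.out.ne_zero))
        hA P hP' =
      kummerMapTorsion (W.baseChange K) ((p ^ 1 : ℕ) : ℤ)
        ((W.baseChange K).zsmul_geomPoints_surjective_of_charZero (by exact_mod_cast pow_ne_zero 1 hp.out.ne_zero))
        P₀ := by
    rintro P hP' rfl
    exact kolyvaginClass_toGeomPoints hA P₀ hP'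
  exact key _ hP hgeom

/-! ## §2 The Kummer class of a Heegner point is a signed Selmer class -/

omit [NeZero (W.conductorNorm ℤ)] in
/-- **`δ(P) ∈ Sel_∅^μ` for a point `P ∈ E(K)` with `c P = sgnP μ • P + t`, `t` of finite order**, when `E(K)[p] = 0` (`ρ̄_{E,p}`
irreducible, `K` imaginary quadratic): the Kummer class is Selmer at every finite and infinite place
(`kummerMapTorsion_mem_selmerLocalKer`), `c_* δ(P) = δ(c P)` (`conjAct_kummerMapTorsion`), and `δ(t) = 0` because `t ∈ p·E(K)`
(`exists_pow_smul_eq_of_isOfFinAddOrder`). [cite: GrossLMS1991, §5 (5.1), Prop. 6.2] [cite: SilvermanAEC2009, X.§4] -/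
theorem kummerMapTorsion_mem_selQP_empty_of_isOfFinAddOrder (hirr : W.HasIrreducibleModPGaloisRep p)
    (hK : IsImaginaryQuadratic K) (c : K ≃ₐ[ℚ] K) (μ : Bool) (P : (W.baseChange K).toAffine.Point)
    (hPc : IsOfFinAddOrder (WeierstrassCurve.Affine.Point.map (W' := W) (c : K →ₐ[ℚ] K) P - sgnP μ • P)) :
    kummerMapTorsion (W.baseChange K) ((p ^ 1 : ℕ) : ℤ)
        ((W.baseChange K).zsmul_geomPoints_surjective_of_charZero (by exact_mod_cast pow_ne_zero 1 hp.out.ne_zero)) P ∈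
      SelQP W K p c ∅ μ := by
  set hdiv := (W.baseChange K).zsmul_geomPoints_surjective_of_charZero (n := ((p ^ 1 : ℕ) : ℤ))
    (by exact_mod_cast pow_ne_zero 1 hp.out.ne_zero) with hhdiv
  -- `E(K)[p] = 0`
  have hbot := torsionBy_eq_bot_of_isImaginaryQuadratic_of_hasIrreducibleModPGaloisRep W K hK hp.out hirr
  have hnoptor : ∀ a : (W.baseChange K).toAffine.Point, p • a = 0 → a = 0 := by
    intro a ha
    have hmem : a ∈ AddSubgroup.torsionBy (W.baseChange K).toAffine.Point (p : ℤ) :=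
      AddSubgroup.torsionBy.nsmul_iff.mpr ha
    rw [hbot] at hmem
    exact (AddSubgroup.mem_bot).mp hmem
  -- the torsion discrepancy is `p`-divisible, hence killed by `δ`
  obtain ⟨s, hs⟩ := exists_pow_smul_eq_of_isOfFinAddOrder hp.out hnoptor hPc 1
  have hmap : WeierstrassCurve.Affine.Point.map (W' := W) (c : K →ₐ[ℚ] K) P = ((p : ℤ) ^ 1) • s + sgnP μ • P := by
    rw [hs, sub_add_cancel]
  have hkill : ((p : ℤ) ^ 1) • kummerMapTorsion (W.baseChange K) ((p ^ 1 : ℕ) : ℤ) hdiv s = 0 := by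
    have h := zsmul_discreteH1_torsion (n := ((p ^ 1 : ℕ) : ℤ)) (kummerMapTorsion (W.baseChange K) ((p ^ 1 : ℕ) : ℤ) hdiv s)
    rw [show ((p : ℤ) ^ 1) = ((p ^ 1 : ℕ) : ℤ) from (Nat.cast_pow p 1).symm]
    exact h
  refine (mem_selQP_iff W K p c ∅ μ _).mpr ⟨?_, fun w ↦ kummerMapTorsion_mem_selmerLocalKer _ _ _ w.Completion P,
    fun v _ ↦ kummerMapTorsion_mem_selmerLocalKer _ _ _ (v.adicCompletion K) P,
    fun q hq ↦ absurd hq (Finset.notMem_empty q)⟩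
  rw [conjAct_kummerMapTorsion, hmap, map_add, map_zsmul, map_zsmul, hkill, zero_add]

/-- **The Kummer class of a HEEGNER point is a signed Selmer class: `δ(P_K) ∈ Sel_∅^μ` with `sgnP μ = −w(E/ℚ)`** (`μ := (w = −1)`):
at a frame with `ρ̄_{E,p}` irreducible, `K` imaginary quadratic with the Heegner hypothesis for `N_E` and `c ≠ 1`, for every Heegner
point `P₀ ∈ E(K)` of level `N_E`. The sign is the PROVED reflection fact `heegnerPoint_conj_add_rootNumber_smul_holds` (Darmon 2004
Prop. 3.11: `c P_K = −w(E/ℚ) P_K` mod `E(K)_tors`; Gross 1991 Prop. 5.3). [cite: Darmon2004, Prop. 3.11] [cite: GrossLMS1991, Prop. 5.3,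
§5 (5.1)] -/
theorem kummerMapTorsion_mem_selQP_empty_of_isHeegnerPoint (hirr : W.HasIrreducibleModPGaloisRep p)
    (hK : IsImaginaryQuadratic K) (hH : SatisfiesHeegnerHypothesis (W.conductorNorm ℤ) K) {c : K ≃ₐ[ℚ] K} (hc1 : c ≠ 1)
    {P₀ : (W.baseChange K).toAffine.Point} (hP₀ : IsHeegnerPoint (W.conductorNorm ℤ) W K P₀) :
    kummerMapTorsion (W.baseChange K) ((p ^ 1 : ℕ) : ℤ)
        ((W.baseChange K).zsmul_geomPoints_surjective_of_charZero (by exact_mod_cast pow_ne_zero 1 hp.out.ne_zero)) P₀ ∈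
      SelQP W K p c ∅ (decide (W.rootNumber = -1)) := by
  have hσ : (c : K →ₐ[ℚ] K) ≠ AlgHom.id ℚ K := by
    intro h
    apply hc1
    apply AlgEquiv.ext
    intro x
    exact DFunLike.congr_fun h x
  have htor := heegnerPoint_conj_add_rootNumber_smul_holds W K hK hH hP₀ (c : K →ₐ[ℚ] K) hσ
  refine kummerMapTorsion_mem_selQP_empty_of_isOfFinAddOrder W p K hirr hK c _ P₀ ?_
  rcases rootNumber_eq_one_or W with hw | hw
  · -- `w = +1`: `c P + P` torsion, `μ = false`, `sgnP μ = −1`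
    have hμ : decide (W.rootNumber = -1) = false := by rw [hw]; decide
    rw [hμ, show sgnP false = -1 from rfl, neg_one_zsmul, sub_neg_eq_add]
    rw [hw, one_zsmul] at htor
    exact htor
  · -- `w = −1`: `c P − P` torsion, `μ = true`, `sgnP μ = 1`
    have hμ : decide (W.rootNumber = -1) = true := by rw [hw]; decide
    rw [hμ, show sgnP true = 1 from rfl, one_zsmul]
    rw [hw, neg_one_zsmul, ← sub_eq_add_neg] at htor
    exact htor

/-! ## §3 The `selmer_bottom` binder -/

omit [W.IsGloballyMinimal] in
/-- **`c(1)` IS A SIGNED SELMER CLASS: `d.kolyvaginClass _ 1 ∈ SelQP W K p c ∅ μ`, `sgnP μ = −w(E/ℚ)`** — for EVERY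
conductor-`1` Kolyvagin–Heegner datum `d` on the frame `(Dt, β, ι)`, at `ρ̄_{E,p}` onto, `K` imaginary quadratic with the Heegner
hypothesis for `N_E`, `c ≠ 1`. Junk branch: the class is `0`. Admissible branch: `c(1) = δ(P₀)` for the Heegner point `P₀ ∈ E(K)`
under `P(1)` (§1 + akr-p3's `exists_isHeegnerPoint_map_eq_derivedPoint_one`), then §2. [cite: GrossLMS1991, §4 (4.4), Prop. 5.3,
Prop. 6.2] [cite: Darmon2004, Prop. 3.11, Thm. 3.7] -/
theorem kolyvaginClass_one_mem_selQP_empty [W.IsGloballyMinimal] (hsurj : W.HasSurjectiveModNGaloisRep p)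
    (hK : IsImaginaryQuadratic K) (hH : SatisfiesHeegnerHypothesis (W.conductorNorm ℤ) K) {c : K ≃ₐ[ℚ] K} (hc1 : c ≠ 1)
    (d : KolyvaginHeegnerData Dt β ι 1) :
    d.kolyvaginClass hp.out 1 ∈ SelQP W K p c ∅ (decide (W.rootNumber = -1)) := by
  by_cases hadm : IsAdmissible (absoluteGaloisGroup K) d.pointsSubgroup ((p ^ 1 : ℕ) : ℤ) ∧
      d.toGeomPoints d.derivedPoint ∈ invPoints (absoluteGaloisGroup K) d.pointsSubgroup ((p ^ 1 : ℕ) : ℤ)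
  swap
  · have h0 : d.kolyvaginClass hp.out 1 = 0 := by
      by_contra hne
      exact hadm (d.kolyvaginClass_ne_zero hne)
    rw [h0]
    exact Submodule.zero_mem _
  obtain ⟨hA, hP⟩ := hadm
  obtain ⟨P₀, hHeeg, hP₀⟩ := exists_isHeegnerPoint_map_eq_derivedPoint_one W K Dt β ι hK hH d
  rw [kolyvaginClass_one_eq_kummerMapTorsion W p K Dt β ι d P₀ hP₀ hA hP]
  exact kummerMapTorsion_mem_selQP_empty_of_isHeegnerPoint W p K
    (hasIrreducibleModPGaloisRep_of_hasSurjectiveModNGaloisRep W p hsurj) hK hH hc1 hHeeg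

omit [W.IsGloballyMinimal] in
/-- **The `selmer_bottom` binder of the rigidity chain, DISCHARGED for realisation data**: if the level-`∅` classes of a
would-be level system are REALISED by Kolyvagin–Heegner data (the carrier's `realisation` field ∕ the assemblies' binder:
`κ₀ m ∅ = d.kolyvaginClass _ 1` for a datum `d` of conductor `∏ m`), then the conductor-one bottom class `κ₀ ∅ ∅` is a signed
Selmer class: `∃ μ, κ₀ ∅ ∅ ∈ SelQP W K p c ∅ μ` — verbatim the `selmer_bottom` hypothesis of
`nonempty_levelKolyvaginSystemP_of_bipartite_of_seed[_at_frame ∕ _of_published ∕ _of_poitouTate ∕ _of_published_free]` and of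
`nonempty_levelKolyvaginSystemP_of_reciprocity_of_ignition`. [cite: GrossLMS1991, §4 (4.4), Prop. 5.3, Prop. 6.2] -/
theorem selmer_bottom_of_realisation [W.IsGloballyMinimal] (hsurj : W.HasSurjectiveModNGaloisRep p)
    (hK : IsImaginaryQuadratic K) (hH : SatisfiesHeegnerHypothesis (W.conductorNorm ℤ) K) {c : K ≃ₐ[ℚ] K} (hc1 : c ≠ 1)
    (κ₀ : Finset {ℓ // Zhang2014.IsKolyvaginPrime (W.conductorNorm ℤ) W K p ℓ} → Finset (AdmQ W K p) → Vp W K p)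
    (realisation : ∀ m : Finset {ℓ // Zhang2014.IsKolyvaginPrime (W.conductorNorm ℤ) W K p ℓ},
      ∃ d : KolyvaginHeegnerData Dt β ι (∏ ℓ ∈ m, (ℓ : ℕ)), κ₀ m ∅ = d.kolyvaginClass (Fact.out : p.Prime) 1) :
    ∃ μ : Bool, κ₀ ∅ ∅ ∈ SelQP W K p c ∅ μ := by
  obtain ⟨d, hd⟩ := realisation ∅
  refine ⟨decide (W.rootNumber = -1), ?_⟩
  rw [hd]
  exact kolyvaginClass_one_mem_selQP_empty W p K Dt β ι hsurj hK hH hc1 d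

end Summit.BirchSwinnertonDyer.BirchSwinnertonDyer.Theorems.AdditiveKoly

end
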